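import Summits.BirchSwinnertonDyer.BirchSwinnertonDyer.Theses.CongruentShaFreeCut
import Summits.BirchSwinnertonDyer.BirchSwinnertonDyer.Theorems.CongruentShaFreeCutKatoZetaRoadPinnedH2
import Summits.BirchSwinnertonDyer.BirchSwinnertonDyer.Theorems.CongruentShaFreeCutKatoReading31b
import Summits.BirchSwinnertonDyer.BirchSwinnertonDyer.Theorems.CongruentShaFreeCutKatoZetaRoadReadings
import Summits.BirchSwinnertonDyer.BirchSwinnertonDyer.Theorems.CongruentShaFreeCutKatoReading31
import Literature.NumberTheory.EllipticCurves.Kato2004.IwasawaCohomologyExistsProofs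
import Literature.NumberTheory.EllipticCurves.Kato2004.LocPKernelRankOneProofs
import Summits.BirchSwinnertonDyer.BirchSwinnertonDyer.Theorems.CongruentShaFreeCutIntegralH1RankLeOne
import Literature.NumberTheory.EllipticCurves.Kato2004.IwasawaH1ProjZeroKernelProofs
import Literature.NumberTheory.EllipticCurves.Kato2004.IwasawaH1RankLowerBoundProofs
import Summits.BirchSwinnertonDyer.BirchSwinnertonDyer.Theorems.CongruentShaFreeCutKatoZetaRoadNontrivialH1
import Summits.BirchSwinnertonDyer.BirchSwinnertonDyer.Theorems.CongruentShaFreeCutKatoZetaRoadLogZeroH2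

set_option linter.dupNamespace false

/-! # BC3 skeleton — crux `AnalyticRankOneOfRankOneFiniteShaTwo` (route `CongruentShaFreeCut`, rung S2;
stmt-BirchSwinnertonDyer-19080), line `kato-zeta-perrin-riou` (**v1i** = RI7′ ∧ `LogZeroAtTwoH2`, READY under plan g22
RULING-1 / WAKE-plan-g22-v1i: the S2 LogZero census `Theorems/CongruentShaFreeCutKatoZetaRoadLogZero.lean` (p530262) and the
named def module `Theorems/CongruentShaFreeCutKatoZetaRoadLogZeroH2.lean` (`LogZeroAtTwoH2`, p531972) are in the tree; the plan's
act (xviii) registers) — prepared by the prover seat `bsd-cn100-s2-c3` g17 (2026-08-27). Written from the REGISTERED v1h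
(21ecf8ddefeaef7f…) by ONE stub edit: the research stub `stub_prFormulaAtTwo : PRFormulaAtTwoH2` (Perrin-Riou's FORMULA at the
additive prime `2`, «`∃ c ≠ 0`, `log(loc₂ ι[z]) = c · log_ω(P)²`») is REPLACED by the strictly weaker (in design), NAMED
`stub_logZeroAtTwo : LogZeroAtTwoH2` = (V₂), its ANNIHILATION HALF («at a TORSION Heegner point `P` — i.e. `ord_{s=1} L(E_n,s) ≥ 3`
here —, `L(E_n,1) = 0` ⟹ every v2-pinned Kato descent datum with Kato's Main Conjecture in `Λ ⊗ ℚ₂` has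
`HasLocPKummerLog (E_n) 2 pin.katoClass 0`»; no constant `c`, no embedding `ι : K → ℚ₂` — both were idle on the road: the v1h
composition consumed PR₂ through `obtain ⟨c, hc, hPRx⟩` with `hc` never used, only at a torsion `P`); monotonicity certificate
`CongruentShaFreeCutKatoZetaRoadLogZeroH2.logZeroH2_of_prFormulaH2 : PRFormulaAtTwoH2 → LogZeroAtTwoH2`. `stub_refereedInputs` = RI7′
(six refereed theorems ∧ `Kato2004.one_le_rank_iwasawaH1`, `.2.2.2.2.2.2` last) and the in-skeleton readings `readingRK` /
`reading31` / `reading31b` are TOKEN-IDENTICAL with v1h; the composition is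
`CongruentShaFreeCutKatoZetaRoadLogZeroH2.cruxB_of_logZeroH2_of_readings_rankOne` (= p530262's `cruxB_of_logZero_of_readings_rankOne`
with `hV : LogZeroAtTwoH2` by name; the by-name door `cruxB_of_registeredRI7prime_of_logZeroH2 stub_refereedInputs stub_logZeroAtTwo`
is the same term up to unfolding). Farm: rc 0, sorries EXACTLY 2 (`stub_refereedInputs`, `stub_logZeroAtTwo`), audit `_of_stubs` →
crux B BY NAME. END STATE: SEVEN citation-borne inputs, ALL refereed print + tree theorems + ONE research statement (V₂), the (⟹)
half of Perrin-Riou 1993 Conj. 3.3.2 in the local Kummer currency (= BSTW24 Conj. 1.12 (a)+(b) at `ord ≠ 1`; BDV22 Thm. A at a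
torsion `P`) — 0 sources at the additive, potentially supersingular prime `2` of `E_n` (PR93 good reduction; BSTW24 Thm. 1.13
`p ∤ 2N`; BDV22 semistable odd `p`; Delbourgo 2002 potentially ordinary `p ≥ 5`). HISTORY: v1 → v1b → v1d (RI 11) → v1e (RI 9) →
v1r (RI 8′) → v1g (RI 7) → v1h (RI 7′) → v1i (RI 7′, PR₂ ↦ V₂).

THE LINE (Burungale–Skinner, App. A of arXiv:2210.10730, Thm. 10.1 / §10.1.3, run at the ADDITIVE prime 2 of E_n over
Kato's PINNED descent datum — v2 pin `KatoDescentDatumPinH2`): crux B ⟸ seven citation-borne facts + tree theorems +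
ONE research statement `LogZeroAtTwoH2`. HONESTY: the re-cut buys a sharper statement of what the road consumes, NOT
provability; nothing about BSD, the leaf, crux B, RI7′, (V₂) or PR₂ is proved here. PARTITION: none (RANK axis). -/

noncomputable section

open scoped Classical

namespace Summit.BirchSwinnertonDyer.BirchSwinnertonDyer.Cruxes.AnalyticRankOneOfRankOneFiniteShaTwo.KatoZetaPerrinRiou

open WeierstrassCurve NumberField IsDedekindDomain Field Literature.NumberTheory.EllipticCurves
  Literature.NumberTheory.EllipticCurves.ModularForms Literature.NumberTheory.EllipticCurves.Kato2004
  Literature.NumberTheory.EllipticCurves.Kato2004.EulerSystemValues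
  Literature.NumberTheory.GaloisRepresentations
  Summit.BirchSwinnertonDyer.Rank1Residual.Additive
  Summit.BirchSwinnertonDyer.BirchSwinnertonDyer.Theses.CongruentShaFreeCut
  Summit.BirchSwinnertonDyer.BirchSwinnertonDyer.Theorems.CongruentShaFreeCutKatoDescentDatumOfH2
  Summit.BirchSwinnertonDyer.BirchSwinnertonDyer.Theorems.CongruentShaFreeCutKatoZetaRoadPinnedH2
  Summit.BirchSwinnertonDyer.BirchSwinnertonDyer.Theorems.CongruentShaFreeCutKatoZetaRoadLogZeroH2

/-- **stub_refereedInputs** (size S, CITATION-BORNE; RI7′): the six refereed inputs of v5dp (2-parity, modularity, Hoffstein–Luo,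
Kato finiteness, Heegner points, Gross–Zagier + Kolyvagin) AND Kato's (12.2.2)-consequence `one_le_rank_iwasawaH1`
(`1 ≤ rank_Λ 𝐇¹_Γ(T_pW)` at every cyclotomic pin) — v1h: the v1g conjunct `thm12_4` is REPLACED by this strictly weaker named fact
(everything else the road consumed of `thm12_4` being tree theorems under crux B's hypotheses: (α) p510488, (12.2.1), torsion-freeness,
(R1) p508547, (R2) p514042).
[cite: DokchitserDokchitserAnnals2010, Thm. 1.4] [cite: Kato2004Asterisque, Cor. 14.3, §12.2 (12.2.1)–(12.2.2), §14.14 (14.14.1)–(14.14.2), (14.9.3), §14.1]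
[cite: GrossZagier1986, Thm. I.6.3 with V.§2] [cite: Gross1984, §§3–4] -/
theorem stub_refereedInputs :
    (∀ (W : WeierstrassCurve ℚ) [W.IsElliptic] (p : ℕ) [Fact p.Prime], p_parity W p) ∧
    ModularForms.exists_isNewformOf ∧
    HoffsteinLuo1997_exists_twist_L_one_ne_zero ∧
    (∀ (W : WeierstrassCurve ℚ) [W.IsElliptic] (p : ℕ) [Fact p.Prime],
      kato_finite_of_L_one_ne_zero W p) ∧
    (∀ (W : WeierstrassCurve ℚ) (K : Type) [Field K] [NumberField K], exists_isHeegnerPoint W K) ∧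
    (∀ (W : WeierstrassCurve ℚ) (N : ℕ) [NeZero N] (K : Type) [Field K] [NumberField K],
      analyticRankEK_eq_one_iff_heegner_nonTorsion W N K) ∧
    one_le_rank_iwasawaH1 := by
  sorry

/-- **readingRK** — PROVED in-skeleton, AT THE PIN and UNDER CRUX B's HYPOTHESES (`rank E_n(ℚ) = 1`, `#Ш(E_n)[2^∞] < ∞`), from
the TREE THEOREMS `nonempty_iwasawaH1Data_holds`, (α) `nonempty_iwasawaH2Data_holds` (p510488), (12.2.1)
`IwasawaH1Data.module_finite_of_isCyclotomic`, torsion-freeness `IwasawaH1Data.isTorsionFree`, (R1) `rank_integralH1_layerZero_le_one`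
(p508547), (R2) `IwasawaH1Data.rank_le_one_of_rank_integralH1_le_one` (p514042) and conjunct 7 of `stub_refereedInputs`
(`one_le_rank_iwasawaH1`, through `nontrivial_of_one_le_rank_iwasawaH1`) by the seat's landed
`CongruentShaFreeCutKatoReadingsOfNontrivialH1.readingRK_congruentNumberCurve_of_nontrivial` (p515014; z chosen by char-ideal algebra, ty g8 p469342).
[cite: Kato2004Asterisque, §12.2 (12.2.2) (p. 220), Thm. 12.4 (p. 221) and §14.14 (14.14.1) (p. 243)] -/
theorem readingRK :
    ∀ ⦃n : ℕ⦄, Squarefree n →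
      ∀ [(congruentNumberCurve n).IsElliptic] [(congruentNumberCurve n).IsGloballyMinimal]
        [ContinuousSMul ℤ_[2] ((congruentNumberCurve n).tateModule 2)],
        (congruentNumberCurve n).mordellWeilRank = 1 →
          Finite (AddCommGroup.primaryComponent (congruentNumberCurve n).sha 2) →
        ∃ D : KatoDescentDatum 2, Nonempty (KatoDescentDatumPinH2 (congruentNumberCurve n) 2 D) ∧
          ∃ a b : ℕ,
            Ideal.span {((2 : ℕ) : IwasawaAlgebra 2) ^ a} * Module.charIdeal (IwasawaAlgebra 2) D.H2 =
              Ideal.span {((2 : ℕ) : IwasawaAlgebra 2) ^ b} *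
                Module.charIdeal (IwasawaAlgebra 2) (D.H ⧸ (IwasawaAlgebra 2) ∙ D.z) :=
  Summit.BirchSwinnertonDyer.BirchSwinnertonDyer.Theorems.CongruentShaFreeCutKatoReadingsOfNontrivialH1.readingRK_congruentNumberCurve_of_nontrivial
    (nontrivial_of_one_le_rank_iwasawaH1 stub_refereedInputs.2.2.2.2.2.2)

/-- **reading31** — PROVED in-skeleton: the former named fact `finite_descentCokernel_of_rankOne` is DERIVED from conjunct 7 of
`stub_refereedInputs` (`one_le_rank_iwasawaH1` ⟹ (NT)) and the tree theorems (α), (12.2.1), torsion-freeness, (R1) by the seat's landed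
`CongruentShaFreeCutKatoReadingsOfNontrivialH1.reading31_of_nontrivial` (p515014, over `Kato2004.finite_descentCokernel_of_rankOne_of_nontrivial_of_rank_le_one`
p514042 and `CongruentShaFreeCutKatoReading31.reading31_of_fact`). [cite: Kato2004Asterisque, (14.9.3) (p. 240) and §14.14 (14.14.2) (p. 243)] [cite: AlpogeBhargavaShnidman2022, App. A §10.1.3 (p. 34)] -/
theorem reading31 :
    ∀ ⦃n : ℕ⦄, Squarefree n →
      ∀ [(congruentNumberCurve n).IsElliptic] [(congruentNumberCurve n).IsGloballyMinimal]
        [ContinuousSMul ℤ_[2] ((congruentNumberCurve n).tateModule 2)]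
        (D : KatoDescentDatum 2), Nonempty (KatoDescentDatumPinH2 (congruentNumberCurve n) 2 D) →
        (congruentNumberCurve n).mordellWeilRank = 1 →
          Finite (AddCommGroup.primaryComponent (congruentNumberCurve n).sha 2) →
            Finite (IwasawaAlgebra.coinvariants 2 D.H2) :=
  Summit.BirchSwinnertonDyer.BirchSwinnertonDyer.Theorems.CongruentShaFreeCutKatoReadingsOfNontrivialH1.reading31_of_nontrivial
    (nontrivial_of_one_le_rank_iwasawaH1 stub_refereedInputs.2.2.2.2.2.2)

/-- **reading31b** — PROVED in-skeleton from the TREE THEOREM `Kato2004.locP_kernel_isTorsion_of_rankOne_holds` (v1e; Kato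
§14.1 + (14.9.3) read in rank one, discharged p484260) by seat bsd-cn100-s2b-c3 g6's landed
`CongruentShaFreeCutKatoReading31b.reading31b_two_of_fact` (local half: `Additive.LocalLog.padicLog_eq_zero_iff`, AEC IV.6.4). [cite: AlpogeBhargavaShnidman2022, App. A §10.1.3 (p. 34)] [cite: Kato2004Asterisque, §14.9 (14.9.3) (p. 240)] -/
theorem reading31b :
    ∀ ⦃n : ℕ⦄, Squarefree n →
      ∀ [(congruentNumberCurve n).IsElliptic] [(congruentNumberCurve n).IsGloballyMinimal]
        [ContinuousSMul ℤ_[2] ((congruentNumberCurve n).tateModule 2)]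
        (D : KatoDescentDatum 2) (pin : KatoDescentDatumPinH2 (congruentNumberCurve n) 2 D),
        (congruentNumberCurve n).mordellWeilRank = 1 →
          Finite (AddCommGroup.primaryComponent (congruentNumberCurve n).sha 2) →
            (∀ m : ℕ, 2 ^ m • D.ι (Submodule.Quotient.mk D.z) ≠ 0) →
              ∀ t : ℚ_[2], HasLocPKummerLog (congruentNumberCurve n) 2 pin.katoClass t → t ≠ 0 :=
  Summit.BirchSwinnertonDyer.BirchSwinnertonDyer.Theorems.CongruentShaFreeCutKatoReading31b.reading31b_two_of_fact
    locP_kernel_isTorsion_of_rankOne_holds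

/-- **stub_logZeroAtTwo** (XL, OPEN — THE research statement of the line, v1i): the NAMED annihilation half (V₂)
`LogZeroAtTwoH2` (`Theorems/CongruentShaFreeCutKatoZetaRoadLogZeroH2.lean`) of Perrin-Riou's formula for Kato's zeta element of
`E_n` at the additive prime `2`, over the v2 pin: at a TORSION Heegner point, `L(E_n,1) = 0` ⟹ the pinned Kato class has `2`-adic
Kummer logarithm `0`. Implied by the v1h stub `PRFormulaAtTwoH2` (`logZeroH2_of_prFormulaH2`); the (⟹) half of Perrin-Riou 1993
Conj. 3.3.2 in the local Kummer currency; 0 sources at an additive prime.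
[cite: PerrinRiou1993AIF, §3.3, Conj. 3.3.2 and Formule 3.3.4 (pp. 975–977)] [cite: BurungaleSkinnerTianWan2024, Conj. 1.12 (a)+(b)]
[cite: BertoliniDarmonVenerucci2022, Thm. A (1)–(2)] [cite: AlpogeBhargavaShnidman2022, App. A Thm. 10.8 (a) (p. 33) and §2 after Thm. 2.10] -/
theorem stub_logZeroAtTwo : LogZeroAtTwoH2 := by
  sorry

/-- The skeleton composition: crux B by the LANDED readings-form door
`CongruentShaFreeCutKatoZetaRoadLogZeroH2.cruxB_of_logZeroH2_of_readings_rankOne` (p531972; = p530262's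
`CongruentShaFreeCutKatoZetaRoadLogZero.cruxB_of_logZero_of_readings_rankOne`, i.e. the v1h composition
`…NontrivialH1.cruxB_of_prFormulaH2_of_readings_rankOne` with `hPR` ↦ `hV : LogZeroAtTwoH2`) — the only theorem of this file
concluding the crux by name. -/
theorem AnalyticRankOneOfRankOneFiniteShaTwo_of_stubs : AnalyticRankOneOfRankOneFiniteShaTwo :=
  Summit.BirchSwinnertonDyer.BirchSwinnertonDyer.Theorems.CongruentShaFreeCutKatoZetaRoadLogZeroH2.cruxB_of_logZeroH2_of_readings_rankOne
    stub_refereedInputs.1 stub_refereedInputs.2.1 stub_refereedInputs.2.2.1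
    stub_refereedInputs.2.2.2.1 stub_refereedInputs.2.2.2.2.1 stub_refereedInputs.2.2.2.2.2.1
    readingRK reading31 reading31b stub_logZeroAtTwo

end Summit.BirchSwinnertonDyer.BirchSwinnertonDyer.Cruxes.AnalyticRankOneOfRankOneFiniteShaTwo.KatoZetaPerrinRiou

end
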